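import Summits.Ventures.Crystal3D.Theorems.StickyWulffConstantCoaxialWallLawHealCapTen
import HarnessLib

/-!
# The JUNK CAP TABLE as one `JunkCapBound` instance: monotonicity of the cap inputs, pattern rows, the kissing row, and `capTable₀` (crux `CoaxialWallLaw`,
# stmt-Ventures-19481; line `WallLedgerF`, skeleton 'CoaxialWallLawCertificates' v8.1, stub `stub_incoherentSeamSmall`, input `JunkCapBound` of `…SeamIncoherentAssembly`)

HONEST FRAMING. Venture `Summits/Ventures/Crystal3D` (cell `crystal3d-full`); the analytic input `JunkCapBound cap` of
`TailResidue.incoherentSeamSmall_of_assembly` ('…SeamIncoherentAssembly') DISCHARGED for a first concrete cap function `capTable₀`, plus the algebra that lets later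
rows LOWER the table without touching what is landed.  Nothing about the stubs is claimed; the certificate input `CoherentCoreCap` and the sparsity input are NOT
touched; F-C1 not moved.
* MONOTONICITY: `junkCapBound_mono` (a larger cap is easier), `capPool_anti` / `capSummand_mono` / `coherentCoreCap_anti` (a SMALLER cap is easier for the
  certificate), `coherentCoreCap_mono_right`; `junkCapBound_min` — two junk cap bounds give the bound for the pointwise minimum.  CONSEQUENCE: the certificate side
  may be run against ANY cap function that dominates pointwise a cap function with a landed `JunkCapBound`; every further row landed as `JunkCapBound row` lowers
  the usable table to `cap ⊓ row` by `junkCapBound_min`.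
* PATTERN ROWS: `patternCap pat r D y := if (∃ frame L, pat L D y) then r else 12` and `junkCapBound_patternCap` — a frame-pattern row lemma of the shape of
  `…SeamJunkCapRows` / `…HealCapTen` becomes a `JunkCapBound` instance; `patternCap_le_of_pat` — the value the certificate side reads off an exhibited frame.
* THE KISSING ROW `kissingCap D y := 12 − deg_D y` (`junkCapBound_kissingCap`, from `card_filter_dist_eq_one_le_twelve` = `musin2006_kissing_three_holds`).
* THE THREE LANDED SLOT ROWS as instances: `nineCap` (closed lower half-dozen ⇒ `2`, `junk_contacts_le_two_of_closedHalf`), `tenCap` (nine + upper slot `8` ⇒ `1`,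
  `junk_contacts_le_one_of_ten`), `elevenCap` (eleven slots ⇒ `0`, `junk_contacts_eq_zero_of_eleven`).
* **`capTable₀ := kissingCap ⊓ elevenCap ⊓ tenCap ⊓ nineCap`** and **`junkCapBound_capTable₀ : JunkCapBound capTable₀`** — the input of the assembly, discharged for
  this table; `capTable₀_le_*` — the four upper bounds the certificate enumeration uses.
WHAT THIS IS NOT: the rows «hexagon − 1 + lower triple», hexagon-only, `{100}` square and the hcp-dozen variants are NOT here (they enter later as further
`JunkCapBound row` instances through `junkCapBound_min`); no certificate, no sparsity; F-C1 not moved.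
-/

noncomputable section

namespace Summit.Ventures.Crystal3D.Theorems

namespace TailResidue

open Summit.Ventures.Crystal3D Finset NearIdentity
open scoped InnerProductSpace

/-! ### Monotonicity of the two cap inputs -/

section Mono

variable {cap cap' : Finset (EuclideanSpace ℝ (Fin 3)) → EuclideanSpace ℝ (Fin 3) → ℕ}

/-- **A larger cap function is easier for the junk bound.** -/
theorem junkCapBound_mono (h : JunkCapBound cap) (hle : ∀ D y, cap D y ≤ cap' D y) : JunkCapBound cap' :=
  fun X hX z hz S y hy hzy => (h X hX z hz S y hy hzy).trans (hle _ _)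

/-- **Two junk cap bounds give the bound for the pointwise minimum** (how further rows lower the table). -/
theorem junkCapBound_min (h : JunkCapBound cap) (h' : JunkCapBound cap') : JunkCapBound fun D y => min (cap D y) (cap' D y) :=
  fun X hX z hz S y hy hzy => le_min (h X hX z hz S y hy hzy) (h' X hX z hz S y hy hzy)

open scoped Classical in
/-- A smaller cap function gives larger lowered pools. -/
theorem capPool_anti (hle : ∀ D y, cap D y ≤ cap' D y) (D : Finset (EuclideanSpace ℝ (Fin 3))) (b : EuclideanSpace ℝ (Fin 3)) :
    capPool cap' D b ≤ capPool cap D b := by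
  unfold capPool
  have : ∑ y ∈ D.filter (fun y => dist b y ≤ 1), (cap D y : ℝ) ≤ ∑ y ∈ D.filter (fun y => dist b y ≤ 1), (cap' D y : ℝ) :=
    sum_le_sum fun y _ => by exact_mod_cast hle D y
  linarith

open scoped Classical in
/-- A smaller cap function gives a smaller lowered summand, provided the larger cap's lowered pools are positive at the loaded balls. -/
theorem capSummand_mono (hle : ∀ D y, cap D y ≤ cap' D y) (v : WordVersion) (S₁ S₂ : PlateSystem) (D : Finset (EuclideanSpace ℝ (Fin 3)))
    (z : EuclideanSpace ℝ (Fin 3)) (hpos : ∀ b ∈ D, dist z b ≤ 1 → 0 < endMultA D v S₁ S₂ b → 0 < capPool cap' D b) :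
    capSummand cap v S₁ S₂ D z ≤ capSummand cap' v S₁ S₂ D z := by
  unfold capSummand
  refine sum_le_sum fun b hb => ?_
  obtain ⟨hbD, hzb, he⟩ := mem_filter.1 hb
  exact div_le_div_of_nonneg_left (Nat.cast_nonneg _) (hpos b hbD hzb he) (capPool_anti hle D b)

/-- **A SMALLER cap function is easier for the certificate**: `CoherentCoreCap cap' s₁ → cap ≤ cap' → CoherentCoreCap cap s₁`. -/
theorem coherentCoreCap_anti {s₁ : ℝ} (h : CoherentCoreCap cap' s₁) (hle : ∀ D y, cap D y ≤ cap' D y) : CoherentCoreCap cap s₁ := by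
  intro L D hD z hz hdeg hco
  obtain ⟨hpos, hsum⟩ := h L D hD z hz hdeg hco
  refine ⟨fun b hb hzb he => lt_of_lt_of_le (hpos b hb hzb he) (capPool_anti hle D b), ?_⟩
  exact (capSummand_mono hle _ _ _ D z hpos).trans hsum

/-- The certificate is monotone in the line. -/
theorem coherentCoreCap_mono_right {s₁ s₂ : ℝ} (h : CoherentCoreCap cap s₁) (hs : s₁ ≤ s₂) : CoherentCoreCap cap s₂ := by
  intro L D hD z hz hdeg hco
  obtain ⟨hpos, hsum⟩ := h L D hD z hz hdeg hco
  exact ⟨hpos, hsum.trans hs⟩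

end Mono

/-! ### Pattern rows -/

section Pattern

variable (pat : (EuclideanSpace ℝ (Fin 3) ≃ₗᵢ[ℝ] EuclideanSpace ℝ (Fin 3)) → Finset (EuclideanSpace ℝ (Fin 3)) → EuclideanSpace ℝ (Fin 3) → Prop) (r : ℕ)

open scoped Classical in
/-- A PATTERN ROW of the cap table: value `r` at a core ball `y` whose core neighbourhood shows the frame pattern `pat` for SOME frame `L`, the kissing number `12`
otherwise. -/
def patternCap (D : Finset (EuclideanSpace ℝ (Fin 3))) (y : EuclideanSpace ℝ (Fin 3)) : ℕ :=
  if ∃ L : EuclideanSpace ℝ (Fin 3) ≃ₗᵢ[ℝ] EuclideanSpace ℝ (Fin 3), pat L D y then r else 12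

variable {pat r}

open scoped Classical in
/-- **The value the certificate reads**: an exhibited frame with the pattern bounds the row by `r`. -/
theorem patternCap_le_of_pat {D : Finset (EuclideanSpace ℝ (Fin 3))} {y : EuclideanSpace ℝ (Fin 3)} (L : EuclideanSpace ℝ (Fin 3) ≃ₗᵢ[ℝ] EuclideanSpace ℝ (Fin 3))
    (h : pat L D y) : patternCap pat r D y ≤ r := by
  unfold patternCap
  rw [if_pos ⟨L, h⟩]

open scoped Classical in
/-- A pattern row never exceeds `12`. -/
theorem patternCap_le_twelve (hr : r ≤ 12) (D : Finset (EuclideanSpace ℝ (Fin 3))) (y : EuclideanSpace ℝ (Fin 3)) : patternCap pat r D y ≤ 12 := by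
  unfold patternCap
  split_ifs
  · exact hr
  · exact le_rfl

open scoped Classical in
/-- Junk contacts of any ball number at most `12` (kissing). -/
theorem junk_contacts_le_twelve {X : Finset (EuclideanSpace ℝ (Fin 3))} (hX : ∀ p ∈ X, ∀ q ∈ X, p ≠ q → 1 ≤ dist p q)
    (D : Finset (EuclideanSpace ℝ (Fin 3))) (y : EuclideanSpace ℝ (Fin 3)) : ((X \ D).filter fun x => dist y x = 1).card ≤ 12 :=
  (card_le_card fun _ hx => mem_filter.2 ⟨(mem_sdiff.1 (mem_filter.1 hx).1).1, (mem_filter.1 hx).2⟩).trans (card_filter_dist_eq_one_le_twelve X hX y)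

open scoped Classical in
/-- **A frame-pattern row lemma becomes a `JunkCapBound` instance.** -/
theorem junkCapBound_patternCap
    (hrow : ∀ X : Finset (EuclideanSpace ℝ (Fin 3)), (∀ p ∈ X, ∀ q ∈ X, p ≠ q → 1 ≤ dist p q) →
      ∀ z ∈ X, ∀ S : EuclideanSpace ℝ (Fin 3) ≃ₗᵢ[ℝ] EuclideanSpace ℝ (Fin 3), ∀ y ∈ coreOf X z S, dist z y ≤ 2 →
      ∀ L : EuclideanSpace ℝ (Fin 3) ≃ₗᵢ[ℝ] EuclideanSpace ℝ (Fin 3), pat L (coreOf X z S) y →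
        ((X \ coreOf X z S).filter fun x => dist y x = 1).card ≤ r) :
    JunkCapBound (patternCap pat r) := by
  intro X hX z hz S y hy hzy
  unfold patternCap
  split_ifs with h
  · obtain ⟨L, hL⟩ := h
    exact hrow X hX z hz S y hy hzy L hL
  · exact junk_contacts_le_twelve hX _ y

end Pattern

/-! ### The kissing row -/

open scoped Classical in
/-- THE KISSING ROW: `12 −` (number of core contacts of `y`). -/
def kissingCap (D : Finset (EuclideanSpace ℝ (Fin 3))) (y : EuclideanSpace ℝ (Fin 3)) : ℕ := 12 - (D.filter fun q => dist y q = 1).card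

open scoped Classical in
/-- **The kissing row is a junk cap bound**: junk contacts + core contacts `≤ 12`. -/
theorem junkCapBound_kissingCap : JunkCapBound kissingCap := by
  intro X hX z hz S y hy hzy
  set D := coreOf X z S with hD
  have hDX : D ⊆ X := coreOf_subset X z S
  have hdisj : Disjoint ((X \ D).filter fun x => dist y x = 1) (D.filter fun q => dist y q = 1) := by
    rw [disjoint_left]
    intro x hx hx'
    exact (mem_sdiff.1 (mem_filter.1 hx).1).2 (mem_filter.1 hx').1
  have hsub : ((X \ D).filter fun x => dist y x = 1) ∪ (D.filter fun q => dist y q = 1) ⊆ X.filter fun q => dist y q = 1 := by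
    intro x hx
    rcases mem_union.1 hx with h | h
    · exact mem_filter.2 ⟨(mem_sdiff.1 (mem_filter.1 h).1).1, (mem_filter.1 h).2⟩
    · exact mem_filter.2 ⟨hDX (mem_filter.1 h).1, (mem_filter.1 h).2⟩
  have h12 := card_filter_dist_eq_one_le_twelve X hX y
  have hsum := (card_union_of_disjoint hdisj).symm.trans_le ((card_le_card hsub).trans h12)
  unfold kissingCap
  omega

/-! ### The three landed slot rows as instances -/

/-- Pattern «closed lower half-dozen»: the nine positions `y + L(slot)`, `slot ∈ lowerNine`, are core balls. -/
def NinePat (L : EuclideanSpace ℝ (Fin 3) ≃ₗᵢ[ℝ] EuclideanSpace ℝ (Fin 3)) (D : Finset (EuclideanSpace ℝ (Fin 3))) (y : EuclideanSpace ℝ (Fin 3)) : Prop :=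
  ∀ k ∈ lowerNine, y + L (slotSite k) ∈ D

/-- Pattern «ten slots»: closed lower half-dozen and the upper slot `8`. -/
def TenPat (L : EuclideanSpace ℝ (Fin 3) ≃ₗᵢ[ℝ] EuclideanSpace ℝ (Fin 3)) (D : Finset (EuclideanSpace ℝ (Fin 3))) (y : EuclideanSpace ℝ (Fin 3)) : Prop :=
  (∀ k ∈ lowerNine, y + L (slotSite k) ∈ D) ∧ y + L (slotSite 8) ∈ D

/-- Pattern «eleven slots»: every slot except the upper slot `2`. -/
def ElevenPat (L : EuclideanSpace ℝ (Fin 3) ≃ₗᵢ[ℝ] EuclideanSpace ℝ (Fin 3)) (D : Finset (EuclideanSpace ℝ (Fin 3))) (y : EuclideanSpace ℝ (Fin 3)) : Prop :=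
  ∀ k : Fin 12, k ≠ 2 → y + L (slotSite k) ∈ D

/-- Row «closed lower half-dozen ⇒ `2`». -/
def nineCap : Finset (EuclideanSpace ℝ (Fin 3)) → EuclideanSpace ℝ (Fin 3) → ℕ := patternCap NinePat 2

/-- Row «ten slots ⇒ `1`». -/
def tenCap : Finset (EuclideanSpace ℝ (Fin 3)) → EuclideanSpace ℝ (Fin 3) → ℕ := patternCap TenPat 1

/-- Row «eleven slots ⇒ `0`». -/
def elevenCap : Finset (EuclideanSpace ℝ (Fin 3)) → EuclideanSpace ℝ (Fin 3) → ℕ := patternCap ElevenPat 0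

/-- The nine-slot row is a junk cap bound (`junk_contacts_le_two_of_closedHalf`). -/
theorem junkCapBound_nineCap : JunkCapBound nineCap :=
  junkCapBound_patternCap fun _ hX _ _ S _ hy hzy L hL => junk_contacts_le_two_of_closedHalf hX S hy hzy L hL

/-- The ten-slot row is a junk cap bound (`junk_contacts_le_one_of_ten`). -/
theorem junkCapBound_tenCap : JunkCapBound tenCap :=
  junkCapBound_patternCap fun _ hX _ _ S _ hy hzy L hL => junk_contacts_le_one_of_ten hX S hy hzy L hL.1 hL.2

/-- The eleven-slot row is a junk cap bound (`junk_contacts_eq_zero_of_eleven`). -/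
theorem junkCapBound_elevenCap : JunkCapBound elevenCap :=
  junkCapBound_patternCap fun _ hX _ _ S _ hy hzy L hL => (junk_contacts_eq_zero_of_eleven hX S hy hzy L hL).le

/-! ### The table and the discharged input -/

/-- **THE FIRST CAP TABLE**: kissing row ⊓ eleven-slot row ⊓ ten-slot row ⊓ nine-slot row. -/
def capTable₀ (D : Finset (EuclideanSpace ℝ (Fin 3))) (y : EuclideanSpace ℝ (Fin 3)) : ℕ :=
  min (min (min (kissingCap D y) (elevenCap D y)) (tenCap D y)) (nineCap D y)

/-- **`JunkCapBound capTable₀`** — the junk-cap input of `incoherentSeamSmall_of_assembly`, discharged for the first table. -/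
theorem junkCapBound_capTable₀ : JunkCapBound capTable₀ :=
  junkCapBound_min (junkCapBound_min (junkCapBound_min junkCapBound_kissingCap junkCapBound_elevenCap) junkCapBound_tenCap) junkCapBound_nineCap

open scoped Classical in
/-- Reading the table, kissing row: `capTable₀ D y ≤ 12 − deg_D y`. -/
theorem capTable₀_le_kissing (D : Finset (EuclideanSpace ℝ (Fin 3))) (y : EuclideanSpace ℝ (Fin 3)) :
    capTable₀ D y ≤ 12 - (D.filter fun q => dist y q = 1).card :=
  (min_le_left _ _).trans ((min_le_left _ _).trans (min_le_left _ _))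

/-- Reading the table, eleven-slot row: an exhibited frame with eleven core slots gives `capTable₀ D y = 0`. -/
theorem capTable₀_eq_zero_of_eleven {D : Finset (EuclideanSpace ℝ (Fin 3))} {y : EuclideanSpace ℝ (Fin 3)} (L : EuclideanSpace ℝ (Fin 3) ≃ₗᵢ[ℝ] EuclideanSpace ℝ (Fin 3))
    (h : ∀ k : Fin 12, k ≠ 2 → y + L (slotSite k) ∈ D) : capTable₀ D y = 0 :=
  Nat.le_zero.1 ((min_le_left _ _).trans ((min_le_left _ _).trans ((min_le_right _ _).trans (patternCap_le_of_pat (pat := ElevenPat) L h))))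

/-- Reading the table, ten-slot row: an exhibited frame with the nine closed-lower-half slots and slot `8` in the core gives `capTable₀ D y ≤ 1`. -/
theorem capTable₀_le_one_of_ten {D : Finset (EuclideanSpace ℝ (Fin 3))} {y : EuclideanSpace ℝ (Fin 3)} (L : EuclideanSpace ℝ (Fin 3) ≃ₗᵢ[ℝ] EuclideanSpace ℝ (Fin 3))
    (h : ∀ k ∈ lowerNine, y + L (slotSite k) ∈ D) (h8 : y + L (slotSite 8) ∈ D) : capTable₀ D y ≤ 1 :=
  (min_le_left _ _).trans ((min_le_right _ _).trans (patternCap_le_of_pat (pat := TenPat) L ⟨h, h8⟩))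

/-- Reading the table, nine-slot row: an exhibited frame with the nine closed-lower-half slots in the core gives `capTable₀ D y ≤ 2`. -/
theorem capTable₀_le_two_of_nine {D : Finset (EuclideanSpace ℝ (Fin 3))} {y : EuclideanSpace ℝ (Fin 3)} (L : EuclideanSpace ℝ (Fin 3) ≃ₗᵢ[ℝ] EuclideanSpace ℝ (Fin 3))
    (h : ∀ k ∈ lowerNine, y + L (slotSite k) ∈ D) : capTable₀ D y ≤ 2 :=
  (min_le_right _ _).trans (patternCap_le_of_pat (pat := NinePat) L h)

/-- **The assembly with the junk-cap input discharged**: for any cap function dominating `capTable₀` pointwise (the certificate side's choice), an erosion-lowered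
coherent certificate and seam sparsity give the Σ-form incoherent stub. -/
theorem incoherentSeamSmall_of_cert_of_sparsity {cap : Finset (EuclideanSpace ℝ (Fin 3)) → EuclideanSpace ℝ (Fin 3) → ℕ} (hle : ∀ D y, capTable₀ D y ≤ cap D y)
    {s s₁ p₀ : ℝ} {n₀ k₀ : ℕ} (hcert : CoherentCoreCap cap s₁) (hsp : SeamSparsity p₀ n₀ k₀) (hp₀ : 0 < p₀) (hs : s₁ + n₀ / p₀ ≤ s) :
    IncoherentSeamSmall s k₀ :=
  incoherentSeamSmall_of_assembly cap hcert (junkCapBound_mono junkCapBound_capTable₀ hle) hsp hp₀ hs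

end TailResidue

end Summit.Ventures.Crystal3D.Theorems

end
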